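import Literature.Probability.LatticeModels.DoubleCurrentsNoPercolation
import Literature.Probability.LatticeModels.DoubleCurrentsShift
import HarnessLib

/-!
# ADS15 Thm. 3.1 for the infinite-volume double current — the discharge

Topic `Probability/LatticeModels`, namespace `Literature.Probability.LatticeModels`. Proof-only
companion of `DoubleCurrentsInfinite.lean`: it **discharges the named fact
`Literature.Probability.LatticeModels.ads_percolatesAt_zero_of_lroTildeSq`**, i.e. Theorem 3.1 of

* M. Aizenman, H. Duminil-Copin, V. Sidoravicius, *Random currents and continuity of Ising
  model's spontaneous magnetization*, Comm. Math. Phys. **334** (2015) 719–742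
  (arXiv:1311.1937v3, §3.1; bib key `AizenmanDuminilCopinSidoraviciusCMP2015`, "ADS15"),
  Thm. 3.1: "For `β` at which `M̃_LRO(β) = 0`, also `ℙ_β[0 ↔ ∞] = 0`",

for the infinite-volume double random current `ℙ_β = adsDoubleCurrentLawInf d β` of the
nearest-neighbour Ising model on `ℤ^d` (`β > 0`).

## The proof

Everything is already in the tree; this file only assembles it under the fact's `_holds` name
(the fact's own file cannot host the proof: both ingredients import it).

* `ads_percolatesAt_zero_of_lroTildeSq_of_shift_invariant` (`DoubleCurrentsNoPercolation.lean`):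
  Thm. 3.1 follows from the shift invariance R2 of `ℙ_β` alone — ADS15 §3.1 with Lemma 2.6 (box
  insertion tolerance, passed to the local limit), (3.4) `ℙ_β[x ↔ y] ≤ ⟨σ_xσ_y⟩⁰_β` (switching
  lemma (3.2)–(3.3) in finite volume and the limit), and the density bound (3.5) in the form
  `ℙ_β[0 ↔ ∞]² ≤ 2|B|⁻² ∑_{x,y∈B} ℙ_β[x ↔ y]`, which needs only "at most two infinite clusters"
  (the ergodicity-free half of Burton–Keane) instead of the uniqueness Thm. 2.5; optimising over
  `B` gives `ℙ_β[0 ↔ ∞]² ≤ 2 M̃_LRO(β)² = 0`.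
* `ads_doubleCurrent_shift_invariant_holds` (`DoubleCurrentsShift.lean`): R2, ADS15 Thm. 2.3, for
  the double current (the translate of the local limit is again the local limit, which is unique;
  existence R1 is `ads_doubleCurrent_limit_exists_holds`, `DoubleCurrentsLimit.lean`).

Deliberately not here: the finite-volume reading `ads_exitProb_tendsto_zero_of_lroTildeSq_holds`
and the consequences `plusPair_eq_freePair_of_lroTildeSq_holds`,
`spontaneousMagnetization_criticalBeta_eq_zero_holds`, which live in `CriticalTwoPointBounds.lean`.

## Mathlib status

No random currents / dependent percolation in Mathlib; nothing from Mathlib is used beyond what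
the two imported tree files use.
-/

noncomputable section

namespace Literature.Probability.LatticeModels

variable {d : ℕ}

/-- **ADS15 Thm. 3.1, proved** (Aizenman–Duminil-Copin–Sidoravicius, CMP 334 (2015), §3.1,
Thm. 3.1: "For `β` at which `M̃_LRO(β) = 0`, also `ℙ_β[0 ↔ ∞] = 0`"): discharge of the named fact
`ads_percolatesAt_zero_of_lroTildeSq` of `DoubleCurrentsInfinite.lean` — for the nearest-neighbour
Ising model on `ℤ^d` and `β > 0`, if `M̃_LRO(β)² = 0` (`lroTildeSq d β = 0`) then the origin
percolates with probability zero under the infinite-volume double current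
`ℙ_β = adsDoubleCurrentLawInf d β`. Assembled from the tree's
`ads_percolatesAt_zero_of_lroTildeSq_of_shift_invariant` (Thm. 3.1 from R2, via Lemma 2.6, (3.4)
and the two-cluster form of (3.5)) and `ads_doubleCurrent_shift_invariant_holds` (Thm. 2.3 R2). [cite: AizenmanDuminilCopinSidoraviciusCMP2015, Thm. 3.1] -/
theorem ads_percolatesAt_zero_of_lroTildeSq_holds : ads_percolatesAt_zero_of_lroTildeSq (d := d) :=
  ads_percolatesAt_zero_of_lroTildeSq_of_shift_invariant ads_doubleCurrent_shift_invariant_holds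

end Literature.Probability.LatticeModels
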